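import Literature.NumberTheory.EllipticCurves.UniversalOrdinaryRing
import Literature.RingTheory.FormalGroups.FunctionalEquationIntegrality
import HarnessLib

/-!
# `K = R̂[1/p]` and Blakestad–Grant's functional-equation engine over the universal ordinary ring

Trunk T-NT-EC (Literature/NumberTheory/EllipticCurves). Sequel of `UniversalOrdinaryRing.lean`
(`R̂ = completeRing p`, the `p`-adic completion of `ℤ[A₄,A₆][1/H]`, with its Frobenius lifts
`α`). Blakestad–Grant (J. Number Theory 249 (2023), §2.2) prove the integrality of the universal
Mazur–Tate sigma function `σ = t·exp(g)`, `g = ∫ζ̃ω ∈ (R̂ ⊗ ℚ)⟦t⟧`, by Hazewinkel's functional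
equation lemma in the form of their Cor. 6(c): a functional equation
`g(t) - p⁻¹ α(g)(t') ∈ R̂⟦t⟧` (Prop. 13(b)) forces `exp(g) ∈ R̂⟦t⟧`. The tree has Cor. 6(c)
abstractly (`Literature.RingTheory.FormalGroups.coeff_exp_subst_mem_of_functionalEquation_subst`:
a `ℚ`-algebra `K`, a subring `A` with `ℤ_(p) ⊆ A`, `K = A[1/p]`, an endomorphism `α` of `K`
preserving `A` with `α ≡ Frob (mod pA)`). This file instantiates it on THE ring:

* `completeRingQ p = K = R̂[1/p]` (`Localization.Away p`; Blakestad–Grant's `R̂ ⊗ ℚ`), a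
  `ℚ`-algebra (`algebraRat_completeRingQ`, via `ratCast`: every nonzero integer `pᵏm` is a unit,
  `isUnit_intCast_completeRingQ`), a domain containing `R̂` for `p ≥ 5`
  (`algebraMap_completeRingQ_injective`, `isDomain_completeRingQ`);
* `intSubring p = R̂ ⊆ K` with the three structural hypotheses of Cor. 6:
  `algebraMap_one_div_mem_intSubring` (`ℤ_(p) ⊆ R̂`), `exists_pow_mul_mem_intSubring`
  (`K = R̂[1/p]`), and for any ring endomorphism `α` of `R̂` its extension
  `extendQ p α = α_K : K → K` (`extendQ_algebraMap`, `extendQ_mem_intSubring`,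
  `exists_extendQ_eq_pow_add`: `α_K ≡ Frob (mod p)` on `R̂` when `α` is a Frobenius lift);
* **`coeff_exp_subst_mem_intSubring`, `coeff_exp_subst_mem_intSubring'`,
  `exists_map_eq_exp_subst` — Cor. 6(c) over `R̂`**: for a Frobenius lift `α` of `R̂`,
  `t' ∈ tR̂⟦t⟧` with `t' ≡ tᵖ (mod p)`, and `a ∈ tK⟦t⟧` with `[t¹]a ∈ R̂` satisfying
  `a - p⁻¹ α_K(a)(t') ∈ R̂⟦t⟧`, the series `exp(a)` lies in `R̂⟦t⟧`.

So, on Blakestad–Grant's route to the existence half of `WeierstrassCurve.mazur_tate_sigma_existsUnique`,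
what remains is to produce `α = frobeniusLift p A'₄ A'₆ _ _` and `t'` from the canonical
`p`-isogeny (Prop. 7) and to verify the functional equation for `g` (Prop. 13(b)).

## Sources

* C. Blakestad, D. Grant, J. Number Theory 249 (2023) 348–376 (arXiv:1903.02480), §2.2:
  Lemma 5, Cor. 6(c), Def. 8, proof of Thm. 1. [BlakestadGrant2023]
* M. Hazewinkel, *Formal Groups and Applications* (1978), Ch. I §2.2; N. Koblitz, GTM 58, IV §2
  (Dwork's lemma) — the abstract engine, see `Literature.RingTheory.FormalGroups`.

## Design notes

Definitions introduced (with bodies): `completeRingQ`, `intSubring` (abbrevs), `extendQ`,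
`ratCast`, and the instance `algebraRat_completeRingQ` (`(ratCast p).toAlgebra`; `K` is not a
field, so Mathlib's `algebraRat` does not apply). No named facts. Power series are written
`PowerSeries K` (the file opens `Polynomial`, whose `X`/`C` the Hasse computations of the
prequel use).
-/

noncomputable section

namespace Literature.NumberTheory.EllipticCurves.UniversalOrdinary

open Literature.RingTheory.AdicTopology

/-! ## `K = R̂[1/p]`, its `ℚ`-algebra structure, and the functional-equation engine over `R̂` -/

section InvertP

variable (p : ℕ)

/-- **`K = R̂[1/p] = R̂ ⊗ ℚ`**, the ring in which Blakestad–Grant's `ζ̃`, `g = ∫ζ̃ω`, `σ̃ = exp g`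
have their coefficients (`Localization.Away p`; for `p ≥ 5` a domain containing `R̂`).
[Blakestad–Grant 2023, §2.2 ("power series … with coefficients in `R̂ ⊗ ℚ`")]
[cite: BlakestadGrant2023, §2.2] -/
abbrev completeRingQ : Type := Localization.Away (p : completeRing p)

/-- `p` is a unit of `K`. [folklore] -/
theorem isUnit_natCast_prime_completeRingQ : IsUnit (p : completeRingQ p) := by
  have h := IsLocalization.Away.algebraMap_isUnit (S := completeRingQ p) (p : completeRing p)
  rwa [map_natCast] at h

/-- **`R̂ ⊆ K`**: the subring of `p`-integral elements (the range of `R̂ → K`; for `p ≥ 5` the map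
is injective). [cite: BlakestadGrant2023, §2.2] -/
abbrev intSubring : Subring (completeRingQ p) :=
  (algebraMap (completeRing p) (completeRingQ p)).range

/-- `K = R̂[1/p]`: every element of `K` becomes `p`-integral after multiplication by a power of `p`
(hypothesis `hK` of the functional equation lemma). [folklore] -/
theorem exists_pow_mul_mem_intSubring (x : completeRingQ p) :
    ∃ k : ℕ, (p : completeRingQ p) ^ k * x ∈ intSubring p := by
  obtain ⟨⟨r, s⟩, h⟩ := IsLocalization.surj (Submonoid.powers (p : completeRing p)) x
  obtain ⟨k, hk⟩ := s.2
  refine ⟨k, r, ?_⟩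
  simp only at h
  rw [mul_comm, ← h, ← hk, map_pow, map_natCast]

variable (α : completeRing p →+* completeRing p)

/-- A ring endomorphism of `R̂` preserves the powers of `p`. [folklore] -/
theorem powers_le_comap : Submonoid.powers (p : completeRing p) ≤
    (Submonoid.powers (p : completeRing p)).comap α := by
  rw [Submonoid.powers_le, Submonoid.mem_comap, map_natCast]
  exact Submonoid.mem_powers _

/-- **The extension `α_K : K → K` of a ring endomorphism `α` of `R̂`** (`α(p) = p`).
[Blakestad–Grant 2023, Lemma 5 ("Extend `α` to `K` and then to `K⟦t⟧`")] [cite: BlakestadGrant2023, Lemma 5] -/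
def extendQ : completeRingQ p →+* completeRingQ p :=
  IsLocalization.map (completeRingQ p) α (powers_le_comap p α)

/-- `α_K` restricted to `R̂` is `α`. [folklore] -/
theorem extendQ_algebraMap (x : completeRing p) :
    extendQ p α (algebraMap (completeRing p) (completeRingQ p) x) =
      algebraMap (completeRing p) (completeRingQ p) (α x) :=
  IsLocalization.map_eq (powers_le_comap p α) x

/-- `α_K(R̂) ⊆ R̂` (hypothesis `hαA`). [folklore] -/
theorem extendQ_mem_intSubring {r : completeRingQ p} (hr : r ∈ intSubring p) :
    extendQ p α r ∈ intSubring p := by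
  obtain ⟨x, rfl⟩ := hr
  exact ⟨α x, (extendQ_algebraMap p α x).symm⟩

/-- If `α ≡` Frobenius `(mod p)` on `R̂`, then `α_K(r) = rᵖ + p·a` with `a ∈ R̂` for `r ∈ R̂`
(hypothesis `hα`). [cite: BlakestadGrant2023, Def. 8] -/
theorem exists_extendQ_eq_pow_add (hα : ∀ x, α x - x ^ p ∈ Ideal.span {(p : completeRing p)})
    {r : completeRingQ p} (hr : r ∈ intSubring p) :
    ∃ a ∈ intSubring p, extendQ p α r = r ^ p + p * a := by
  obtain ⟨x, rfl⟩ := hr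
  obtain ⟨y, hy⟩ := Ideal.mem_span_singleton.mp (hα x)
  refine ⟨algebraMap _ _ y, ⟨y, rfl⟩, ?_⟩
  rw [extendQ_algebraMap, eq_add_of_sub_eq hy, map_add, map_mul, map_pow, map_natCast, add_comm]

variable [Fact p.Prime]

/-- Every nonzero natural number is a unit of `K` (`n = pᵏm`, `p ∤ m`: `m ∈ R̂ˣ`, `p ∈ Kˣ`).
[folklore] -/
theorem isUnit_natCast_completeRingQ {n : ℕ} (hn : n ≠ 0) : IsUnit (n : completeRingQ p) := by
  have hp : p.Prime := Fact.out
  obtain ⟨k, m, hm, rfl⟩ := Nat.exists_eq_pow_mul_and_not_dvd hn p hp.one_lt.ne'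
  rw [Nat.cast_mul, Nat.cast_pow]
  refine ((isUnit_natCast_prime_completeRingQ p).pow k).mul ?_
  have hmu : IsUnit (m : completeRing p) :=
    isUnit_natCast_of_coprime ((Nat.Prime.coprime_iff_not_dvd hp).mpr hm).symm
  simpa using hmu.map (algebraMap (completeRing p) (completeRingQ p))

/-- Every nonzero integer is a unit of `K`. [folklore] -/
theorem isUnit_intCast_completeRingQ {n : ℤ} (hn : n ≠ 0) : IsUnit (n : completeRingQ p) := by
  have h : ((n.sign : ℤ) : completeRingQ p) * (n : completeRingQ p) = (n.natAbs : ℕ) := by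
    rw [← Int.cast_mul, Int.sign_mul_self_eq_natAbs, Int.cast_natCast]
  have hu : IsUnit (((n.sign : ℤ) : completeRingQ p) * (n : completeRingQ p)) := by
    rw [h]
    exact isUnit_natCast_completeRingQ p (Int.natAbs_ne_zero.mpr hn)
  exact isUnit_of_mul_isUnit_right hu

/-- The ring map `ℚ → K`. [folklore] -/
def ratCast : ℚ →+* completeRingQ p :=
  IsLocalization.lift (M := nonZeroDivisors ℤ) (S := ℚ) (g := Int.castRingHom (completeRingQ p))
    fun y => isUnit_intCast_completeRingQ p (mem_nonZeroDivisors_iff_ne_zero.mp y.2)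

/-- **`K = R̂[1/p]` is a `ℚ`-algebra.** [Blakestad–Grant 2023, §2.2 (`R̂ ⊗ ℚ`)] [folklore] -/
instance algebraRat_completeRingQ : Algebra ℚ (completeRingQ p) := (ratCast p).toAlgebra

/-- `algebraMap ℚ K (1/m) · m = 1`. [folklore] -/
theorem algebraMap_one_div_mul_natCast {m : ℕ} (hm : m ≠ 0) :
    algebraMap ℚ (completeRingQ p) (1 / m) * (m : completeRingQ p) = 1 := by
  rw [← map_natCast (algebraMap ℚ (completeRingQ p)) m, ← map_mul,
    one_div_mul_cancel (Nat.cast_ne_zero.mpr hm), map_one]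

/-- `ℤ_(p) ⊆ R̂`: `1/m ∈ R̂ ⊆ K` for `p ∤ m` (hypothesis `hA` of the functional equation lemma).
[folklore] -/
theorem algebraMap_one_div_mem_intSubring {m : ℕ} (hm : ¬ p ∣ m) :
    algebraMap ℚ (completeRingQ p) (1 / m) ∈ intSubring p := by
  have hp : p.Prime := Fact.out
  have hm0 : m ≠ 0 := fun h => hm (h ▸ dvd_zero p)
  have hmu : IsUnit (m : completeRing p) :=
    isUnit_natCast_of_coprime ((Nat.Prime.coprime_iff_not_dvd hp).mpr hm).symm
  refine ⟨↑(hmu.unit⁻¹), ?_⟩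
  have h1 : (m : completeRingQ p) * algebraMap ℚ (completeRingQ p) (1 / m) = 1 := by
    rw [mul_comm]; exact algebraMap_one_div_mul_natCast p hm0
  have h2 : algebraMap (completeRing p) (completeRingQ p) ↑(hmu.unit⁻¹) * (m : completeRingQ p) = 1 := by
    rw [← map_natCast (algebraMap (completeRing p) (completeRingQ p)) m, ← map_mul,
      IsUnit.val_inv_mul, map_one]
  exact left_inv_eq_right_inv h2 h1

/-- `p ≠ 0` in `R̂` (`p ≥ 5`). [folklore] -/
theorem natCast_prime_ne_zero (hp5 : 5 ≤ p) : (p : completeRing p) ≠ 0 := by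
  haveI := isDomain_completeRing p hp5
  intro h0
  have h1 : (p : completeRing p) ^ 1 * 1 = 0 := by rw [pow_one, h0, zero_mul]
  exact one_ne_zero ((natCast_pow_mul_eq_zero_iff_completeRing p hp5 1 1).mp h1)

/-- **`R̂ → K` is injective** (`p ≥ 5`). [folklore] -/
theorem algebraMap_completeRingQ_injective (hp5 : 5 ≤ p) :
    Function.Injective (algebraMap (completeRing p) (completeRingQ p)) := by
  haveI := isDomain_completeRing p hp5
  exact IsLocalization.injective (completeRingQ p)
    (powers_le_nonZeroDivisors_of_noZeroDivisors (natCast_prime_ne_zero p hp5))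

/-- `K` is an integral domain (`p ≥ 5`). [folklore] -/
theorem isDomain_completeRingQ (hp5 : 5 ≤ p) : IsDomain (completeRingQ p) := by
  haveI := isDomain_completeRing p hp5
  exact IsLocalization.isDomain_localization
    (powers_le_nonZeroDivisors_of_noZeroDivisors (natCast_prime_ne_zero p hp5))

/-- **Blakestad–Grant's functional-equation engine over `R̂`** (their Cor. 6(c) with `K = R̂[1/p]`,
`A = R̂`, and `α_K` for a Frobenius lift `α` of `R̂` — e.g. `frobeniusLift`; this is the tree's
abstract `Literature.RingTheory.FormalGroups.coeff_exp_subst_mem_of_functionalEquation_subst`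
with all its ring-theoretic hypotheses discharged). Let `α : R̂ → R̂` satisfy
`α(x) ≡ xᵖ (mod p)`, let `t' ∈ K⟦t⟧` have `t'(0) = 0` and `t' ≡ tᵖ (mod pR̂⟦t⟧)`, and let
`a ∈ tK⟦t⟧` with `[t¹]a ∈ R̂`. If `a(t) - p⁻¹·α_K(a)(t')` has coefficients in `R̂`, then
**`exp(a(t))` has coefficients in `R̂`**. With `a = g = ∫ζ̃ω`
(`WeierstrassCurve.sigmaExpArg`, `PadicSigmaOfZetaProofs`) and `t'` the parameter of the
canonically `p`-isogenous curve (Prop. 7(c), Prop. 13(b)), this is the final step of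
Blakestad–Grant's proof of Thm. 1 (`σ = t·exp(g) ∈ R̂⟦t⟧`). [Blakestad–Grant 2023, Cor. 6(c) and
proof of Thm. 1] [cite: BlakestadGrant2023, Cor. 6(c)] -/
theorem coeff_exp_subst_mem_intSubring
    (hα : ∀ x, α x - x ^ p ∈ Ideal.span {(p : completeRing p)})
    {t' : PowerSeries (completeRingQ p)} (ht'0 : PowerSeries.constantCoeff t' = 0)
    (ht' : ∀ n, ∃ b ∈ intSubring p, PowerSeries.coeff n t' = (if n = p then 1 else 0) + p * b)
    {a : PowerSeries (completeRingQ p)} (ha0 : PowerSeries.constantCoeff a = 0)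
    (ha1 : PowerSeries.coeff 1 a ∈ intSubring p)
    (hfe : ∀ n, PowerSeries.coeff n
      (a - (p : ℚ)⁻¹ • (PowerSeries.map (extendQ p α) a).subst t') ∈ intSubring p)
    (n : ℕ) :
    PowerSeries.coeff n ((PowerSeries.exp (completeRingQ p)).subst a) ∈ intSubring p :=
  Literature.RingTheory.FormalGroups.coeff_exp_subst_mem_of_functionalEquation_subst p
    (intSubring p) (extendQ p α) (fun _ hm => algebraMap_one_div_mem_intSubring p hm)
    (exists_pow_mul_mem_intSubring p) (fun _ hr => extendQ_mem_intSubring p α hr)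
    (fun _ hr => exists_extendQ_eq_pow_add p α hα hr) ht'0 ht' ha0 ha1 hfe n

/-- The same with a lift `T' ∈ R̂⟦t⟧` of `t'` given directly: `T'(0) = 0` and
`T' - tᵖ ∈ pR̂⟦t⟧` coefficientwise (Blakestad–Grant, Prop. 7(c): "`t_{p/H}` is in `R̂⟦t⟧` …
and `t_{p/H} ≡ tᵖ mod p`"). [cite: BlakestadGrant2023, Cor. 6(c)] -/
theorem coeff_exp_subst_mem_intSubring'
    (hα : ∀ x, α x - x ^ p ∈ Ideal.span {(p : completeRing p)})
    {T' : PowerSeries (completeRing p)} (hT'0 : PowerSeries.constantCoeff T' = 0)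
    (hT' : ∀ n, PowerSeries.coeff n T' - (if n = p then 1 else 0) ∈ Ideal.span {(p : completeRing p)})
    {a : PowerSeries (completeRingQ p)} (ha0 : PowerSeries.constantCoeff a = 0)
    (ha1 : PowerSeries.coeff 1 a ∈ intSubring p)
    (hfe : ∀ n, PowerSeries.coeff n (a - (p : ℚ)⁻¹ • (PowerSeries.map (extendQ p α) a).subst
      (PowerSeries.map (algebraMap (completeRing p) (completeRingQ p)) T')) ∈ intSubring p)
    (n : ℕ) :
    PowerSeries.coeff n ((PowerSeries.exp (completeRingQ p)).subst a) ∈ intSubring p := by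
  refine coeff_exp_subst_mem_intSubring p α hα ?_ (fun k => ?_) ha0 ha1 hfe n
  · rw [← PowerSeries.coeff_zero_eq_constantCoeff_apply, PowerSeries.coeff_map,
      PowerSeries.coeff_zero_eq_constantCoeff_apply, hT'0, map_zero]
  · obtain ⟨y, hy⟩ := Ideal.mem_span_singleton.mp (hT' k)
    refine ⟨algebraMap _ _ y, ⟨y, rfl⟩, ?_⟩
    rw [PowerSeries.coeff_map, eq_add_of_sub_eq hy, map_add, map_mul, map_natCast, add_comm]
    congr 1
    split_ifs <;> simp

/-- **Existence form**: under the hypotheses of `coeff_exp_subst_mem_intSubring'` there is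
`s ∈ R̂⟦t⟧` mapping to `exp(a)` in `K⟦t⟧` (for `a = ∫ζ̃ω`: Blakestad–Grant's `σ̃ ∈ R̂⟦t⟧`,
Thm. 1; `s` is unique for `p ≥ 5` since `R̂ → K` is injective). [cite: BlakestadGrant2023, Thm. 1] -/
theorem exists_map_eq_exp_subst
    (hα : ∀ x, α x - x ^ p ∈ Ideal.span {(p : completeRing p)})
    {T' : PowerSeries (completeRing p)} (hT'0 : PowerSeries.constantCoeff T' = 0)
    (hT' : ∀ n, PowerSeries.coeff n T' - (if n = p then 1 else 0) ∈ Ideal.span {(p : completeRing p)})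
    {a : PowerSeries (completeRingQ p)} (ha0 : PowerSeries.constantCoeff a = 0)
    (ha1 : PowerSeries.coeff 1 a ∈ intSubring p)
    (hfe : ∀ n, PowerSeries.coeff n (a - (p : ℚ)⁻¹ • (PowerSeries.map (extendQ p α) a).subst
      (PowerSeries.map (algebraMap (completeRing p) (completeRingQ p)) T')) ∈ intSubring p) :
    ∃ s : PowerSeries (completeRing p),
      PowerSeries.map (algebraMap (completeRing p) (completeRingQ p)) s =
        (PowerSeries.exp (completeRingQ p)).subst a := by
  choose c hc using fun n => coeff_exp_subst_mem_intSubring' p α hα hT'0 hT' ha0 ha1 hfe n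
  exact ⟨PowerSeries.mk c, by ext n; rw [PowerSeries.coeff_map, PowerSeries.coeff_mk, hc]⟩

end InvertP

end Literature.NumberTheory.EllipticCurves.UniversalOrdinary
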